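import Literature.AlgebraicGeometry.Resolution.ConjugateDiscsIntegral
import Literature.AlgebraicGeometry.Resolution.RankOneDensity
import HarnessLib

/-!
# The `L₁`-rational cut-out of the disc: polynomial forms of the cut-out function and the cutter

Topic: `Literature/AlgebraicGeometry/Resolution`. Companion of `DiscCutout.lean` for the fields
`hgLpoly, hbpoly, hbfrac` of `RelCurveChart` (`RelativeCurveChartSetup.lean`): in the disc
coordinate `x′ = (x − a)/c` of the `m`-rational disc `|X − a| ≤ |c|` through the point,

* the sheet cutter `b = ∏_{far} (x − aᵢ)/(a − aᵢ)` is the `1`-unit polynomial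
  `B(x′) = ∏_{far} (1 + εᵢ x′)`, `εᵢ = c/(a − aᵢ)`, `|εᵢ| < 1`, whose coefficients lie in `m°`
  (they are in `O_V` by the product form and in `m` because `B = F(a + cX)/F(a)` for the
  `m`-rational far product `F`) — `conjProd_eq_eval_cutterPoly`, `cutterPoly_coeff_mem` — PROVED;
* the cut-out function `g = Q(x)^e/(ν · cNorm)` is `G(x′)` for
  `G = ± ν⁻¹ (∏_{near} (X + δᵢ) · B)^e`, `δᵢ = (a − aᵢ)/c`, with coefficients in `m°` —
  `eq_eval_cutoutPoly`, `cutoutPoly_coeff_mem` — PROVED;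
* a polynomial in `x′` over `m°` is an `m°[x]`-fraction with denominator a power of `c` —
  `exists_mul_eq_eval_of_eval_div` — PROVED.

Everything is [folklore]; no named facts.

## Sources

* M. Temkin, arXiv:0804.1554v3, proof of Thm. 3.3.1, Step 3 (p. 45).
-/

noncomputable section

open scoped BigOperators
open Polynomial

namespace Literature.AlgebraicGeometry.Resolution

namespace ConjugateDiscs

universe u

variable {Ω : Type u} [Field Ω] (V : ValuationSubring Ω)
variable {I : Type u} [Fintype I] (a : I → Ω) (i₀ : I) (c : Ω)

/-! ### Generic bookkeeping -/

omit [Fintype I] in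
/-- Coefficientwise membership in a subring is preserved by finite products. [folklore] -/
theorem coeff_prod_mem (S : Subring Ω) (s : Finset I) (f : I → Polynomial Ω)
    (hf : ∀ i ∈ s, ∀ j, (f i).coeff j ∈ S) (j : ℕ) : (∏ i ∈ s, f i).coeff j ∈ S := by
  classical
  induction s using Finset.induction_on generalizing j with
  | empty => rw [Finset.prod_empty, coeff_one]; split_ifs <;> simp [S.one_mem, S.zero_mem]
  | @insert i s hi ih =>
    rw [Finset.prod_insert hi, coeff_mul]
    exact S.sum_mem fun p _ => S.mul_mem (hf i (Finset.mem_insert_self _ _) _)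
      (ih (fun i' hi' => hf i' (Finset.mem_insert_of_mem hi')) _)

/-- Coefficientwise membership in a subring is preserved by powers. [folklore] -/
theorem coeff_pow_mem (S : Subring Ω) (f : Polynomial Ω) (hf : ∀ j, f.coeff j ∈ S) (n j : ℕ) :
    (f ^ n).coeff j ∈ S := by
  induction n generalizing j with
  | zero => rw [pow_zero, coeff_one]; split_ifs <;> simp [S.one_mem, S.zero_mem]
  | succ n ih =>
    rw [pow_succ, coeff_mul]
    exact S.sum_mem fun p _ => S.mul_mem (ih _) (hf _)

/-- Coefficientwise membership in a subring is preserved by products of two. [folklore] -/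
theorem coeff_mul_mem (S : Subring Ω) (f g : Polynomial Ω) (hf : ∀ j, f.coeff j ∈ S) (hg : ∀ j, g.coeff j ∈ S)
    (j : ℕ) : (f * g).coeff j ∈ S := by
  rw [coeff_mul]
  exact S.sum_mem fun p _ => S.mul_mem (hf _) (hg _)

/-- Coefficientwise membership in a subring is preserved by composition. [folklore] -/
theorem coeff_comp_mem (S : Subring Ω) (f g : Polynomial Ω) (hf : ∀ j, f.coeff j ∈ S) (hg : ∀ j, g.coeff j ∈ S)
    (j : ℕ) : (f.comp g).coeff j ∈ S := by
  rw [comp_eq_sum_left, Polynomial.sum, finsetSum_coeff]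
  refine S.sum_mem fun i _ => ?_
  rw [coeff_C_mul]
  exact S.mul_mem (hf i) (coeff_pow_mem S g hg i j)

/-- `univ = near ⊔ far` for products with values in any commutative monoid. [folklore] -/
theorem prod_univ_eq_near_mul_far {β : Type*} [CommMonoid β] {Γ₀ : Type*}
    [LinearOrderedCommGroupWithZero Γ₀] (w : Valuation Ω Γ₀) (γ : Γ₀) (f : I → β) :
    ∏ i, f i = (∏ i ∈ near w a i₀ γ, f i) * ∏ i ∈ far w a i₀ γ, f i := by
  classical
  have h := (Finset.prod_filter_mul_prod_filter_not Finset.univ (fun i => w (a i - a i₀) ≤ γ) f).symm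
  rw [h]
  congr 1
  refine Finset.prod_congr ?_ fun _ _ => rfl
  ext i
  simp only [Finset.mem_filter, Finset.mem_univ, true_and, mem_far, not_le]

/-- **Polynomials in `x′ = (x − a)/c` over `S` are `S[x]`-fractions with denominator `c^deg`.**
[folklore] -/
theorem exists_mul_eq_eval_of_coeff_mem (S : Subring Ω) {q₀ : Polynomial Ω} (hq₀ : ∀ j, q₀.coeff j ∈ S)
    {a₀ : Ω} (ha₀ : a₀ ∈ S) (hcS : c ∈ S) (hc0 : c ≠ 0) (x : Ω) :
    ∃ q : Polynomial Ω, (∀ j, q.coeff j ∈ S) ∧ c ^ q₀.natDegree * q₀.eval ((x - a₀) / c) = q.eval x := by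
  classical
  set D := q₀.natDegree with hD
  refine ⟨∑ j ∈ Finset.range (D + 1), C (q₀.coeff j * c ^ (D - j)) * (X - C a₀) ^ j, fun i => ?_, ?_⟩
  · rw [finsetSum_coeff]
    refine S.sum_mem fun j _ => ?_
    rw [coeff_C_mul]
    refine S.mul_mem (S.mul_mem (hq₀ j) (S.pow_mem hcS _)) ?_
    exact coeff_pow_mem S _ (fun l => by
      rw [coeff_sub, coeff_X, coeff_C]
      split_ifs <;> simp [S.one_mem, S.zero_mem, S.neg_mem ha₀, S.sub_mem, ha₀]) _ _
  · rw [eval_finsetSum, eval_eq_sum_range, Finset.mul_sum]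
    refine Finset.sum_congr rfl fun j hj => ?_
    have hjD : j ≤ D := Nat.lt_succ_iff.mp (Finset.mem_range.mp hj)
    rw [eval_mul, eval_C, eval_pow, eval_sub, eval_X, eval_C, div_pow]
    have hcj : c ^ j ≠ 0 := pow_ne_zero j hc0
    rw [← mul_assoc, mul_comm (c ^ D), mul_assoc, show c ^ D = c ^ (D - j) * c ^ j by
      rw [← pow_add, Nat.sub_add_cancel hjD], mul_assoc, mul_div_cancel₀ _ hcj]
    ring

/-! ### The cutter polynomial `B` -/

/-- The `1`-unit cutter polynomial `B(X) = ∏_{far} (1 + (c/(a − aᵢ)) X)`. [folklore] -/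
def cutterPoly : Polynomial Ω :=
  ∏ i ∈ far V.valuation a i₀ (V.valuation c), (1 + C (c / (a i₀ - a i)) * X)

variable {V a i₀ c}

/-- **`b = B(x′)`.** [folklore] -/
theorem conjProd_eq_eval_cutterPoly (hc0 : c ≠ 0) (x : Ω) :
    conjProd V.valuation a i₀ (V.valuation c) x = (cutterPoly V a i₀ c).eval ((x - a i₀) / c) := by
  rw [conjProd, cutterPoly, eval_prod]
  refine Finset.prod_congr rfl fun i hi => ?_
  have hne : a i₀ - a i ≠ 0 := far_ne_i₀ hi
  rw [eval_add, eval_one, eval_mul, eval_C, eval_X]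
  field_simp
  ring

/-- The coefficients of `B` lie in `O_V` (`|c/(a − aᵢ)| < 1` for far `i`). [folklore] -/
theorem cutterPoly_coeff_mem_V (j : ℕ) : (cutterPoly V a i₀ c).coeff j ∈ V := by
  refine coeff_prod_mem V.toSubring _ _ (fun i hi l => ?_) j
  have hε : c / (a i₀ - a i) ∈ V := by
    rw [← V.valuation_le_one_iff, map_div₀, Valuation.map_sub_swap]
    exact (div_le_one₀ (lt_of_le_of_lt zero_le (mem_far.mp hi))).mpr (mem_far.mp hi).le
  rcases l with _ | _ | l
  · simp [coeff_one]
  · simpa [coeff_one, coeff_C_mul, coeff_X] using hε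
  · simp [coeff_one]

/-- `F(a) B = F(a + cX)` for the far product `F = ∏_{far} (X − aᵢ)`. [folklore] -/
theorem C_mul_cutterPoly_eq :
    C (∏ i ∈ far V.valuation a i₀ (V.valuation c), (a i₀ - a i)) * cutterPoly V a i₀ c =
      (∏ i ∈ far V.valuation a i₀ (V.valuation c), (X - C (a i))).comp (C (a i₀) + C c * X) := by
  rw [cutterPoly, map_prod, ← Finset.prod_mul_distrib, prod_comp]
  refine Finset.prod_congr rfl fun i hi => ?_
  have hne : a i₀ - a i ≠ 0 := far_ne_i₀ hi
  rw [sub_comp, X_comp, C_comp, mul_add, mul_one, ← mul_assoc, ← C_mul, mul_div_cancel₀ _ hne]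
  simp only [map_sub]
  ring

/-- The coefficients of `B` lie in `m` when the far product is `m`-rational and `a, c ∈ m`.
[folklore] -/
theorem cutterPoly_coeff_mem (m : Subfield Ω) (ha₀m : a i₀ ∈ m) (hcm : c ∈ m)
    (hFm : ∀ j, (∏ i ∈ far V.valuation a i₀ (V.valuation c), (X - C (a i))).coeff j ∈ m) (j : ℕ) :
    (cutterPoly V a i₀ c).coeff j ∈ m := by
  set F : Polynomial Ω := ∏ i ∈ far V.valuation a i₀ (V.valuation c), (X - C (a i)) with hF
  set Fa : Ω := ∏ i ∈ far V.valuation a i₀ (V.valuation c), (a i₀ - a i) with hFa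
  have hFa0 : Fa ≠ 0 := Finset.prod_ne_zero_iff.mpr fun i hi => far_ne_i₀ hi
  -- `Fa = F(a) ∈ m`
  have hFam : Fa ∈ m := by
    have : Fa = F.eval (a i₀) := by
      rw [hFa, hF, eval_prod]
      exact Finset.prod_congr rfl fun i _ => by rw [eval_sub, eval_X, eval_C]
    rw [this]
    exact eval_mem_subfield_of_coeff_mem hFm ha₀m
  have hB : cutterPoly V a i₀ c = C Fa⁻¹ * F.comp (C (a i₀) + C c * X) := by
    rw [← C_mul_cutterPoly_eq, ← mul_assoc, ← C_mul, inv_mul_cancel₀ hFa0, C_1, one_mul]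
  rw [hB, coeff_C_mul]
  refine m.mul_mem (m.inv_mem hFam) ?_
  refine coeff_comp_mem m.toSubring F _ hFm (fun l => ?_) j
  rcases l with _ | _ | l
  · simpa [coeff_C, coeff_C_mul, coeff_X] using ha₀m
  · simpa [coeff_C, coeff_C_mul, coeff_X] using hcm
  · simp

/-! ### The cut-out polynomial `G` -/

variable (V a i₀ c) in
/-- The near polynomial `N(X) = ∏_{near} (X + (a − aᵢ)/c)`. [folklore] -/
def nearPoly : Polynomial Ω :=
  ∏ i ∈ near V.valuation a i₀ (V.valuation c), (X + C ((a i₀ - a i) / c))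

/-- The coefficients of `N` lie in `O_V` (`|(a − aᵢ)/c| ≤ 1` for near `i`). [folklore] -/
theorem nearPoly_coeff_mem_V (hc0 : c ≠ 0) (j : ℕ) : (nearPoly V a i₀ c).coeff j ∈ V := by
  refine coeff_prod_mem V.toSubring _ _ (fun i hi l => ?_) j
  have hδ : (a i₀ - a i) / c ∈ V := by
    rw [← V.valuation_le_one_iff, map_div₀, Valuation.map_sub_swap]
    exact (div_le_one₀ ((Valuation.pos_iff _).mpr hc0)).mpr (mem_near.mp hi)
  rcases l with _ | _ | l
  · simpa [coeff_X, coeff_C] using hδ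
  · simp [coeff_X]
  · simp [coeff_X]

/-- **`Q(a + cX) = c^{#near} F(a) · N · B`** for `Q = ∏ᵢ (X − aᵢ)`, `F(a) = ∏_{far} (a − aᵢ)`.
[folklore] -/
theorem prod_X_sub_C_comp (hc0 : c ≠ 0) :
    (∏ i, (X - C (a i))).comp (C (a i₀) + C c * X) =
      C (c ^ (near V.valuation a i₀ (V.valuation c)).card *
          ∏ i ∈ far V.valuation a i₀ (V.valuation c), (a i₀ - a i)) *
        (nearPoly V a i₀ c * cutterPoly V a i₀ c) := by
  rw [prod_comp, prod_univ_eq_near_mul_far a i₀ V.valuation (V.valuation c), map_mul,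
    C_pow, mul_mul_mul_comm, C_mul_cutterPoly_eq, prod_comp]
  congr 1
  rw [nearPoly, ← Finset.prod_const, ← Finset.prod_mul_distrib]
  refine Finset.prod_congr rfl fun i _ => ?_
  rw [sub_comp, X_comp, C_comp, mul_add, ← C_mul, mul_div_cancel₀ _ hc0]
  simp only [map_sub]
  ring

variable (V a i₀ c) in
/-- The cut-out polynomial `G = (−1)^{e·#far} ν⁻¹ (N · B)^e`. [folklore] -/
def cutoutPoly (ν : Ω) (e : ℕ) : Polynomial Ω :=
  C (((-1 : Ω) ^ (far V.valuation a i₀ (V.valuation c)).card) ^ e * ν⁻¹) *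
    (nearPoly V a i₀ c * cutterPoly V a i₀ c) ^ e

/-- `∏_{far} (aᵢ − a) = (−1)^{#far} ∏_{far} (a − aᵢ)`. [folklore] -/
theorem prod_far_sub_eq :
    ∏ i ∈ far V.valuation a i₀ (V.valuation c), (a i - a i₀) =
      (-1 : Ω) ^ (far V.valuation a i₀ (V.valuation c)).card *
        ∏ i ∈ far V.valuation a i₀ (V.valuation c), (a i₀ - a i) := by
  rw [← Finset.prod_const, ← Finset.prod_mul_distrib]
  exact Finset.prod_congr rfl fun i _ => by ring

/-- **`g = G(x′)`** from the defining identity `g ν cNorm = Q(x)^e`. [folklore] -/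
theorem eq_eval_cutoutPoly (hc0 : c ≠ 0) {x g₁ ν : Ω} (hν0 : ν ≠ 0) {e : ℕ}
    (hgQ : g₁ * ν * cNorm V a i₀ c e = (∏ i, (x - a i)) ^ e) :
    g₁ = (cutoutPoly V a i₀ c ν e).eval ((x - a i₀) / c) := by
  set x' := (x - a i₀) / c with hx'
  set K₀ : Ω := c ^ (near V.valuation a i₀ (V.valuation c)).card *
    ∏ i ∈ far V.valuation a i₀ (V.valuation c), (a i₀ - a i) with hK₀
  set s : Ω := (-1 : Ω) ^ (far V.valuation a i₀ (V.valuation c)).card with hs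
  have hK₀0 : K₀ ≠ 0 := mul_ne_zero (pow_ne_zero _ hc0)
    (Finset.prod_ne_zero_iff.mpr fun i hi => far_ne_i₀ hi)
  have hs1 : s * s = 1 := by rw [hs, ← mul_pow]; norm_num
  -- `Q(x) = K₀ · (N B)(x′)`
  have hQ : ∏ i, (x - a i) = K₀ * (nearPoly V a i₀ c * cutterPoly V a i₀ c).eval x' := by
    have h1 : x = (C (a i₀) + C c * X).eval x' := by
      rw [eval_add, eval_mul, eval_C, eval_C, eval_X, hx', mul_div_cancel₀ _ hc0]; ring
    have h2 : ∏ i, (x - a i) = (∏ i, (X - C (a i))).eval x := by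
      rw [eval_prod]; exact Finset.prod_congr rfl fun i _ => by rw [eval_sub, eval_X, eval_C]
    rw [h2, h1, ← eval_comp, prod_X_sub_C_comp (V := V) hc0, eval_mul, eval_C]
  -- `cNorm = (s K₀)^e`
  have hcN : cNorm V a i₀ c e = (s * K₀) ^ e := by
    rw [cNorm, prod_far_sub_eq, hK₀, hs]; ring
  have hcN0 : cNorm V a i₀ c e ≠ 0 := by
    rw [hcN]; exact pow_ne_zero _ (mul_ne_zero (by rw [hs]; exact pow_ne_zero _ (neg_ne_zero.mpr one_ne_zero)) hK₀0)
  have hg : g₁ = (∏ i, (x - a i)) ^ e / (ν * cNorm V a i₀ c e) := by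
    rw [eq_div_iff (mul_ne_zero hν0 hcN0), ← hgQ, mul_assoc]
  set E : Ω := (nearPoly V a i₀ c * cutterPoly V a i₀ c).eval x' with hE
  have hR : (cutoutPoly V a i₀ c ν e).eval x' = s ^ e * ν⁻¹ * E ^ e := by
    rw [cutoutPoly, eval_mul, eval_C, eval_pow]
  have hs0 : s ≠ 0 := fun h0 => by rw [h0, mul_zero] at hs1; exact zero_ne_one hs1
  rw [hR, hg, hQ, hcN]
  clear_value K₀ s E
  have hden : ν * (s * K₀) ^ e ≠ 0 := mul_ne_zero hν0 (pow_ne_zero _ (mul_ne_zero hs0 hK₀0))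
  rw [div_eq_iff hden,
    show s ^ e * ν⁻¹ * E ^ e * (ν * (s * K₀) ^ e) = (s * s) ^ e * (ν⁻¹ * ν) * (K₀ * E) ^ e by ring,
    hs1, one_pow, inv_mul_cancel₀ hν0, one_mul, one_mul]

/-- The coefficients of `G` lie in `O_V` when `ν` is a unit of `O_V`. [folklore] -/
theorem cutoutPoly_coeff_mem_V (hc0 : c ≠ 0) {ν : Ω} (hνinv : ν⁻¹ ∈ V) (e j : ℕ) :
    (cutoutPoly V a i₀ c ν e).coeff j ∈ V := by
  rw [cutoutPoly, coeff_C_mul]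
  refine mul_mem (mul_mem (pow_mem (pow_mem (neg_mem (one_mem V)) _) _) hνinv) ?_
  exact coeff_pow_mem V.toSubring _
    (coeff_mul_mem V.toSubring _ _ (nearPoly_coeff_mem_V hc0) cutterPoly_coeff_mem_V) e j

/-- The coefficients of `G` lie in `m` when `Q = ∏ᵢ (X − aᵢ)`, `ν`, `a`, `c` and the far product
are `m`-rational: `G = (ν cNorm)⁻¹ Q(a + cX)^e`. [folklore] -/
theorem cutoutPoly_coeff_mem (hc0 : c ≠ 0) (m : Subfield Ω) (ha₀m : a i₀ ∈ m) (hcm : c ∈ m)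
    (hQm : ∀ j, (∏ i, (X - C (a i))).coeff j ∈ m)
    (hFm : ∀ j, (∏ i ∈ far V.valuation a i₀ (V.valuation c), (X - C (a i))).coeff j ∈ m)
    {ν : Ω} (hνm : ν ∈ m) (hν0 : ν ≠ 0) (e j : ℕ) :
    (cutoutPoly V a i₀ c ν e).coeff j ∈ m := by
  set K₀ : Ω := c ^ (near V.valuation a i₀ (V.valuation c)).card *
    ∏ i ∈ far V.valuation a i₀ (V.valuation c), (a i₀ - a i) with hK₀
  set s : Ω := (-1 : Ω) ^ (far V.valuation a i₀ (V.valuation c)).card with hs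
  have hK₀0 : K₀ ≠ 0 := mul_ne_zero (pow_ne_zero _ hc0)
    (Finset.prod_ne_zero_iff.mpr fun i hi => far_ne_i₀ hi)
  have hs1 : s * s = 1 := by rw [hs, ← mul_pow]; norm_num
  -- `K₀ ∈ m`: `∏_{far} (a − aᵢ) = F(a)`
  have hFam : ∏ i ∈ far V.valuation a i₀ (V.valuation c), (a i₀ - a i) ∈ m := by
    have : ∏ i ∈ far V.valuation a i₀ (V.valuation c), (a i₀ - a i) =
        (∏ i ∈ far V.valuation a i₀ (V.valuation c), (X - C (a i))).eval (a i₀) := by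
      rw [eval_prod]
      exact Finset.prod_congr rfl fun i _ => by rw [eval_sub, eval_X, eval_C]
    rw [this]
    exact eval_mem_subfield_of_coeff_mem hFm ha₀m
  have hK₀m : K₀ ∈ m := m.mul_mem (m.pow_mem hcm _) hFam
  -- `G = C (s^e (ν K₀^e)⁻¹) · (Q.comp L)^e`
  have hcomp : (∏ i, (X - C (a i))).comp (C (a i₀) + C c * X) =
      C K₀ * (nearPoly V a i₀ c * cutterPoly V a i₀ c) := by
    rw [prod_X_sub_C_comp (V := V) hc0]
  have hcut : cutoutPoly V a i₀ c ν e = C (s ^ e * ν⁻¹) * (nearPoly V a i₀ c * cutterPoly V a i₀ c) ^ e := rfl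
  have hG : cutoutPoly V a i₀ c ν e =
      C (s ^ e * (ν * K₀ ^ e)⁻¹) * ((∏ i, (X - C (a i))).comp (C (a i₀) + C c * X)) ^ e := by
    rw [hcomp, hcut]
    clear_value K₀ s
    conv_rhs => rw [mul_pow, ← C_pow, ← mul_assoc, ← C_mul]
    congr 2
    field_simp
  rw [hG, coeff_C_mul]
  refine mul_mem (mul_mem (pow_mem (pow_mem (neg_mem (one_mem m)) _) _)
    (inv_mem (mul_mem hνm (pow_mem hK₀m _)))) ?_
  refine coeff_pow_mem m.toSubring _ (coeff_comp_mem m.toSubring _ _ hQm (fun l => ?_)) e j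
  rcases l with _ | _ | l
  · simpa [coeff_C, coeff_C_mul, coeff_X] using ha₀m
  · simpa [coeff_C, coeff_C_mul, coeff_X] using hcm
  · simp

end ConjugateDiscs

end Literature.AlgebraicGeometry.Resolution

end
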